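import Mathlib
import HarnessLib
import Literature.MathematicalPhysics.QuantumLattice.HubbardResolventJets
import Literature.MathematicalPhysics.QuantumLattice.HubbardFreeCovariance

/-!
# Route `KLProgramme` — crux C4a, LAYER 2: the SLICE SYMBOL AS A PROFILE OF THE LEVEL — smooth and supported in `[−Λ′, Λ′] ⊂ (−r, r)`
# (the `hf`, `hfsupp` hypotheses of the tube tadpole-jet theorem and of the LAYER-2 bricks, for `f := ξ ↦ sliceSymbolFnXi c 0 Λ Λ′ ω ξ`)

Cell `gate-hubbard-kl`, lane hubbard-kl-c4a-1 (g3); helper for stub (C) `stub_twoLeg_curvature` of the engine-flow child `KLRegimeEngineV17F2`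
(stmt-HubbardSuperconductivity-20437); memo HOME/hubbard-kl-c4a-1/C4A-PLAN.md §16.5 (iv).  LAYER 1 (`…TwoLegIncrementRepReading` §4) carries the slice propagator as
`sliceSymbolFnXi (βL²) 0 Λ_{n+1} Λ_n (ω_{p₀}) (e_K(p⃗))` — a function of the LEVEL `ξ = e_K(p⃗)` at a fixed Matsubara frequency `ω_{p₀} ≠ 0`
(`matsubaraFreq_ne_zero`).  The tube tadpole-jet theorem (…C4aTubeTadpoleCert) and the LAYER-2 bricks (…C4aLatticeTubeAlias, …C4aSliceTransform) read such a profile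
through `hf : ContDiff ℝ ∞ f` and `hfsupp : tsupport f ⊆ Ioo (−r) r`.  This file discharges both for the slice symbol:

* `contDiff_sliceSymbolFnXi_level` — `ξ ↦ sliceSymbolFnXi c θ Λ Λ′ ω ξ` is `C^∞` when `ω + θ ≠ 0` (Salmhofer's `C^∞` cutoff `salmhoferCutoff`, the resolvent
  `contDiff_resolventFnXi`);
* `sliceSymbolFnXi_eq_zero_of_lt_abs` — it vanishes for `|ξ| > Λ′` (`0 < Λ ≤ Λ′`; the weight lives on the shell `Λ²/4 ≤ ω² + ξ² ≤ Λ′²`,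
  `sliceWeightFn_eq_zero_of_not_mem`);
* **`tsupport_sliceSymbolFnXi_level_subset`** — `tsupport (ξ ↦ sliceSymbolFnXi c θ Λ Λ′ ω ξ) ⊆ Icc (−Λ′) Λ′ ⊆ Ioo (−r) r` for `Λ′ < r`;
* `sliceSymbolFnXi_matsubara_contDiff` / `…_tsupport_subset` — the LAYER-1 instance `c = βL²`, `θ = 0`, `ω = matsubaraFreq β M p₀` (`β ≠ 0`).

Pure calculus on the tree's objects; nothing is asserted about the Hubbard model.  References: Salmhofer 1999 §4.2.5 (4.70)–(4.71) [cite: Salmhofer1999];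
BGM 2006 §2.2 (2.36aa) [cite: BenfattoGiulianiMastropietro2006].
-/

noncomputable section

namespace Summit.HubbardSuperconductivity.HubbardSuperconductivity.Theorems.C4a

set_option linter.dupNamespace false -- summit = problem name (single-conjunct summit), D-0017

open Real Set
open scoped ContDiff
open Literature.MathematicalPhysics.QuantumLattice

/-- **The slice symbol is `C^∞` in the level** at a frequency with `ω + θ ≠ 0`. [cite: Salmhofer1999, §4.2.5 (4.70)] -/
theorem contDiff_sliceSymbolFnXi_level {c θ w0 : ℝ} (hω : w0 + θ ≠ 0) (Λ Λ' : ℝ) {N : ℕ∞} :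
    ContDiff ℝ N fun ξ : ℝ => sliceSymbolFnXi c θ Λ Λ' w0 ξ := by
  have hw : ContDiff ℝ N fun ξ : ℝ => sliceWeightFn Λ Λ' w0 ξ := by
    unfold sliceWeightFn
    have harg : ∀ a : ℝ, ContDiff ℝ N fun ξ : ℝ => (ξ ^ 2 + w0 ^ 2) / a ^ 2 := fun a =>
      ((contDiff_id.pow 2).add contDiff_const).div_const _
    exact ((contDiff_salmhoferCutoff (n := N)).comp (harg Λ)).sub ((contDiff_salmhoferCutoff (n := N)).comp (harg Λ'))
  have hres : ContDiff ℝ N (resolventFnXi c θ w0) := contDiff_resolventFnXi hω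
  unfold sliceSymbolFnXi
  exact (Complex.ofRealCLM.contDiff.comp hw).mul hres

/-- **Off the shell in the level**: for `0 < Λ ≤ Λ′` and `Λ′ < |ξ|` the slice symbol vanishes (`ω² + ξ² > Λ′²`). [cite: Salmhofer1999, §4.2.5 (4.71)] -/
theorem sliceSymbolFnXi_eq_zero_of_lt_abs {Λ Λ' : ℝ} (hΛ : 0 < Λ) (hΛΛ' : Λ ≤ Λ') (c θ w0 : ℝ) {ξ : ℝ} (hξ : Λ' < |ξ|) :
    sliceSymbolFnXi c θ Λ Λ' w0 ξ = 0 := by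
  have hΛ' : 0 < Λ' := hΛ.trans_le hΛΛ'
  have hsq : Λ' ^ 2 < ξ ^ 2 + w0 ^ 2 := by
    have h1 : Λ' ^ 2 < |ξ| ^ 2 := by nlinarith [abs_nonneg ξ]
    rw [sq_abs] at h1
    nlinarith [sq_nonneg w0]
  have hw := (sliceWeightFn_eq_zero_of_not_mem hΛ hΛΛ' (Or.inr hsq)).1
  unfold sliceSymbolFnXi
  rw [hw, Complex.ofReal_zero, zero_mul]

/-- **The support in the level**: `tsupport (ξ ↦ sliceSymbolFnXi c θ Λ Λ′ ω ξ) ⊆ Icc (−Λ′) Λ′` (`0 < Λ ≤ Λ′`). [cite: Salmhofer1999, §4.2.5 (4.71)] -/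
theorem tsupport_sliceSymbolFnXi_level_subset_Icc {Λ Λ' : ℝ} (hΛ : 0 < Λ) (hΛΛ' : Λ ≤ Λ') (c θ w0 : ℝ) :
    tsupport (fun ξ : ℝ => sliceSymbolFnXi c θ Λ Λ' w0 ξ) ⊆ Icc (-Λ') Λ' := by
  refine closure_minimal ?_ isClosed_Icc
  intro ξ hξ
  rw [Function.mem_support] at hξ
  by_contra hout
  refine hξ (sliceSymbolFnXi_eq_zero_of_lt_abs hΛ hΛΛ' c θ w0 ?_)
  rw [mem_Icc, not_and_or, not_le, not_le] at hout
  rcases hout with h | h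
  · rw [abs_of_neg (by linarith [hΛ.trans_le hΛΛ'])]; linarith
  · exact lt_of_lt_of_le h (le_abs_self ξ)

/-- **The `hfsupp` hypothesis**: for `Λ′ < r`, `tsupport (ξ ↦ sliceSymbolFnXi c θ Λ Λ′ ω ξ) ⊆ Ioo (−r) r`. [cite: Salmhofer1999, §4.2.5 (4.71)] -/
theorem tsupport_sliceSymbolFnXi_level_subset {Λ Λ' r : ℝ} (hΛ : 0 < Λ) (hΛΛ' : Λ ≤ Λ') (hr : Λ' < r) (c θ w0 : ℝ) :
    tsupport (fun ξ : ℝ => sliceSymbolFnXi c θ Λ Λ' w0 ξ) ⊆ Ioo (-r) r :=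
  (tsupport_sliceSymbolFnXi_level_subset_Icc hΛ hΛΛ' c θ w0).trans (Icc_subset_Ioo (by linarith) hr)

/-! ## The LAYER-1 instance: `c = βL²`, `θ = 0`, `ω = ω_{p₀}` a kept Matsubara frequency -/

/-- **The slice propagator of LAYER 1 is a `C^∞` profile of the level** (`β ≠ 0`: Matsubara frequencies are nonzero). [cite: Salmhofer1999, §4.2.5 (4.70)] -/
theorem sliceSymbolFnXi_matsubara_contDiff {β : ℝ} (hβ : β ≠ 0) (L M : ℕ) (p₀ : MatsubaraIdx M) (Λ Λ' : ℝ) :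
    ContDiff ℝ ∞ fun ξ : ℝ => sliceSymbolFnXi (β * (L : ℝ) ^ 2) 0 Λ Λ' (matsubaraFreq β M p₀) ξ :=
  contDiff_sliceSymbolFnXi_level (by rw [add_zero]; exact matsubaraFreq_ne_zero hβ p₀) Λ Λ'

/-- **… and supported in the tube**: `tsupport ⊆ Ioo (−r) r` whenever `0 < Λ ≤ Λ′ < r`. [cite: Salmhofer1999, §4.2.5 (4.71)] -/
theorem sliceSymbolFnXi_matsubara_tsupport_subset {β : ℝ} (L M : ℕ) (p₀ : MatsubaraIdx M) {Λ Λ' r : ℝ} (hΛ : 0 < Λ) (hΛΛ' : Λ ≤ Λ')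
    (hr : Λ' < r) :
    tsupport (fun ξ : ℝ => sliceSymbolFnXi (β * (L : ℝ) ^ 2) 0 Λ Λ' (matsubaraFreq β M p₀) ξ) ⊆ Ioo (-r) r :=
  tsupport_sliceSymbolFnXi_level_subset hΛ hΛΛ' hr _ _ _

end Summit.HubbardSuperconductivity.HubbardSuperconductivity.Theorems.C4a

end
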